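import Summits.ABC.IUTFork.Cor312TeamBCapstoneSettingDHVol
import HarnessLib

/-!
# [IUTchIII] Cor. 3.12, TEAM B — the capstone at `settingDHVol` under `m`-INDEPENDENT Θ-boxes:
# `hΨ` and `hthetaEq0` both DISCHARGED (identity transports), kernel record of the polydisc-model
# observation

Record-only file (D-0012) of the abc-iut cell (Cor. 3.12 strategy TEAM B «estimate / log-Kummer» of
HUMAN RULING D-0067 (3), seat abc-iut-c312-11 = B1, gen 6); PROOF-ONLY (0 defs); TAKES NO SIDE.

This file kernel-records B2's 02:13:56Z model observation (C312-TEAMS.md; announced "will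
kernel-record next", superseded by the 11:30Z window before it was filed): in the hull-set box model
the Θ-boxes are polydiscs determined by their centre NORMS (`hullSet c = polydisc (‖c·‖)`,
`Literature.IUT.LogVolume.hullSet`), so `m`-INDEPENDENT CENTRE NORMS force
`thetaRegion m = thetaRegion 0` LITERALLY — and then the two Kummer-realisation residuals of the
`settingDHVol` capstone (p417670) are dischargeable with the IDENTITY transports:

* `SummandPieces.preservesRegions_id` — the identity preserves any container (trivially);
* `hullSet_eq_of_norm_eq` — hull-sets with componentwise equal centre norms are EQUAL (bookkeeping
  over `hullSet = polydisc ∘ norms`, [IUTchIII] Rmk. 3.9.5 (ii) p. 127; Dupuy–Hilado §4.12 p. 16);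
* `thetaRegion_settingDHVol_eq_zero_of_boxes` / `…_of_hullSet_norm` — `m`-independent Θ-boxes (resp.
  hull-set boxes with `m`-independent centre norms) give `thetaRegion m = thetaRegion 0` at the
  canonical assembled setting (bookkeeping through the `rfl` form `thetaRegion_settingDHVol`);
* `teamB_statement_of_globalVolumeTransport_settingDHVol_of_mIndepBoxes` — **the capstone at
  `settingDHVol` with `Ψm := id`**: the printed `Statement` of Cor. 3.12 from `m`-independent
  Θ-boxes + `hbox0` (hull-set shape of the reference box) + the (Ind3) finiteness residuals
  `hθ`/`hfinθ` + `ThetaFinite` + **the gap input `Cor312Vol.GlobalVolumeTransport`**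
  (G-c312-11-1-SUPPLEMENT, kurims p. 184 l. 30–34) — `hΨ` and `hthetaEq0` GONE. Residual list at the
  canonical real model under `m`-independent boxes, exactly: {box data (`hbox_eq`/`hbox0`), (Ind3)
  finiteness, `ThetaFinite`, THE GAP}. NOTHING asserted about the gap.

HONEST FRAMING (B2's faithfulness note, carried verbatim for the referee lanes): `m`-independence of
the boxes is a MODEL FEATURE of the hull-set instantiation — "the polydisc model cannot separate
same-volume-after-transport from identified boxes" — NOT print's assertion; print's (xi-a) Kummer
transport is the `Ψm`-form (p417670), of which this is the degenerate instance. Whether the printed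
Θ-pilot regions `q^{j²}·𝒪` are `m`-independent in the intended reading is a question for the
instance/referee lanes, not decided here. Sources read on the page (kurims `paper:url-4b091feeb646`):
[IUTchIII] Prop. 3.9 (i)(ii) pp. 115–117, Rmk. 3.9.5 (ii) p. 127, Thm. 3.11 (ii) pp. 155–156,
Cor. 3.12 pp. 173–174, p. 184 ((xi-a)/(xi-g)). [claim: Mochizuki2012, status: disputed]
[cite: DupuyHilado2025, §4.12 p. 16]
NO new definition, NO new `Prop`; no judgement on [IUTchIII] Cor. 3.12; typed ≠ proved.
-/

noncomputable section

open Set Function NumberField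
open Literature.IUT.LogVolume

namespace Summit.ABC

namespace IUTFork

namespace Cor312Vol

open Thm311 Literature.IUT.LogThetaLattice

variable {T : ThetaIndex}

/-- **The identity preserves any container** (degenerate instance of the (Ind2) shape
`PreservesRegions`): every direct product region is its own image and preimage. [folklore] -/
theorem SummandPieces.preservesRegions_id {L : LogShells T} (V : SummandPieces L) (j : T.Label)
    (vQ : T.VQ) : V.PreservesRegions j vQ id :=
  ⟨Function.bijective_id, fun R hR => ⟨R, by rw [image_id], hR, rfl⟩,
    fun R hR => ⟨R, by rw [preimage_id], hR, rfl⟩⟩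

/-- **Hull-sets with componentwise equal centre norms are EQUAL**: `λ·𝒪` is the polydisc of the
centre norms (`hullSet c = polydisc (‖c·‖)`, [IUTchIII] Rmk. 3.9.5 (ii) p. 127; Dupuy–Hilado §4.12
p. 16), which depends on the centre only through its norms. [folklore] -/
theorem hullSet_eq_of_norm_eq {J : Type*} (K : J → Type*) [∀ j, NontriviallyNormedField (K j)]
    {c c' : Π j, K j} (h : ∀ j, ‖c j‖ = ‖c' j‖) : hullSet K c = hullSet K c' := by
  unfold hullSet
  exact congrArg _ (funext h)

end Cor312Vol

namespace Thm311

namespace Real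

open Cor312 Cor312Vol Literature.IUT.LogThetaLattice

variable {F : Type} [Field F] [NumberField F] (X : PilotData F) {logv : PadicLogs F}
  (hlog : LogvAnalytic logv) (M : Type) [Field M] [NumberField M]
  (archPk : ∀ (j : (thetaIndex X).Label) (vQ : (thetaIndex X).VQ),
    Set ((logShellsDH X logv).Packet j vQ))
  (archSub : ∀ (j : (thetaIndex X).Label) (v : (thetaIndex X).V),
    Set ((logShellsDH X logv).Packet j ((thetaIndex X).over v)))
  (Ψ : ℤ → ∀ v : (thetaIndex X).V, v ∈ (thetaIndex X).Vbad →
    Set ((logShellsDH X logv).StarPacket v))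
  (act : ℤ → ∀ v : (thetaIndex X).V, v ∈ (thetaIndex X).Vbad →
    (logShellsDH X logv).StarPacket v → Module.End ℚ ((logShellsDH X logv).StarPacket v))
  (Mmod : ℤ → ∀ j : (thetaIndex X).LabelStar, Set ((logShellsDH X logv).GlobalPacket j.1))
  (region : ℤ → ∀ j : (thetaIndex X).LabelStar, FinDivisor M → ∀ vQ : (thetaIndex X).VQ,
    Set ((logShellsDH X logv).Packet j.1 vQ))
  (n : ℤ) {HT : Type} {LogLink : HT → HT → Type} {IsFull : ∀ {s t : HT}, LogLink s t → Prop}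
  (lat : LGPGaussianLogThetaLattice LogLink IsFull)
  {Frd : Type} {IsoF : Frd → Frd → Type} {Ob : Frd → Type} {realify : Frd → Frd} {Strip : Type}
  {IsoS : Strip → Strip → Type} {Mv : ∀ v : (thetaIndex X).V, v ∈ (thetaIndex X).Vbad → Type}
  [∀ v h, Monoid (Mv v h)]
  (sig : GlobalLGPFrobenioidSignature (thetaIndex X).lstar (thetaIndex X).V
    (· ∈ (thetaIndex X).Vbad) Frd IsoF Ob realify Strip IsoS Mv)
  (split : SplittingMonoids Mv) {ObΔ : Type}
  {N : ∀ v : (thetaIndex X).V, v ∈ (thetaIndex X).Vbad → Type} [∀ v h, Monoid (N v h)]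
  (qData : QPilotData ObΔ N)
  (thetaBox : ℤ → Ob sig.Clgp → ∀ (j : (thetaIndex X).Label) (vQ : (thetaIndex X).VQ),
    Set (∀ s : factorIdxDH X hlog j vQ, factorFieldDH X hlog j vQ s))
  (qCentre : ObΔ → ∀ (j : (thetaIndex X).Label) (vQ : (thetaIndex X).VQ),
    ∀ s : factorIdxDH X hlog j vQ, factorFieldDH X hlog j vQ s)
  (hq : ∀ j vQ s, qCentre (qPilotObject qData) j vQ s ≠ 0)
  (hfin : ∀ j : (thetaIndex X).Label, (Function.support fun vQ =>
    ((situationDHVol X hlog M archPk archSub Ψ act Mmod region).D n).logvol j vQ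
      (factorMapDH X hlog j vQ ⁻¹'
        hullSet (factorFieldDH X hlog j vQ) (qCentre (qPilotObject qData) j vQ))).Finite)

/-- **`m`-independent Θ-boxes identify all Θ-pilot regions**: if the Θ-box of the Θ-pilot object at
every position `m` equals the box at the gluing position `m = 0`, then `thetaRegion m =
thetaRegion 0` at the canonical assembled setting (bookkeeping through the `rfl` form
`thetaRegion_settingDHVol`). [claim: Mochizuki2012, status: disputed] -/
theorem thetaRegion_settingDHVol_eq_zero_of_boxes
    (hbox_eq : ∀ (m : ℤ) (j : (thetaIndex X).Label) (vQ : (thetaIndex X).VQ),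
      thetaBox m (settingDHVol X hlog M archPk archSub Ψ act Mmod region n lat sig split qData
          thetaBox qCentre hq hfin).thetaPilot j vQ =
        thetaBox 0 (settingDHVol X hlog M archPk archSub Ψ act Mmod region n lat sig split qData
          thetaBox qCentre hq hfin).thetaPilot j vQ)
    (m : ℤ) (j : (thetaIndex X).Label) (vQ : (thetaIndex X).VQ) :
    (settingDHVol X hlog M archPk archSub Ψ act Mmod region n lat sig split qData thetaBox qCentre
        hq hfin).thetaRegion m j vQ =
      (settingDHVol X hlog M archPk archSub Ψ act Mmod region n lat sig split qData thetaBox qCentre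
        hq hfin).thetaRegion 0 j vQ := by
  rw [thetaRegion_settingDHVol, thetaRegion_settingDHVol, hbox_eq m j vQ]

/-- **Hull-set Θ-boxes with `m`-independent centre norms identify all Θ-pilot regions** (the
polydisc-model observation, kernel form): if every Θ-box is the hull-set of a centre family `c m`
whose norms do not depend on `m`, then `thetaRegion m = thetaRegion 0`.
[claim: Mochizuki2012, status: disputed] -/
theorem thetaRegion_settingDHVol_eq_zero_of_hullSet_norm
    (c : ℤ → ∀ (j : (thetaIndex X).Label) (vQ : (thetaIndex X).VQ),
      ∀ s : factorIdxDH X hlog j vQ, factorFieldDH X hlog j vQ s)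
    (hhull : ∀ (m : ℤ) (j : (thetaIndex X).Label) (vQ : (thetaIndex X).VQ),
      thetaBox m (settingDHVol X hlog M archPk archSub Ψ act Mmod region n lat sig split qData
          thetaBox qCentre hq hfin).thetaPilot j vQ =
        hullSet (factorFieldDH X hlog j vQ) (c m j vQ))
    (hnorm : ∀ (m : ℤ) (j : (thetaIndex X).Label) (vQ : (thetaIndex X).VQ)
      (s : factorIdxDH X hlog j vQ), ‖c m j vQ s‖ = ‖c 0 j vQ s‖)
    (m : ℤ) (j : (thetaIndex X).Label) (vQ : (thetaIndex X).VQ) :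
    (settingDHVol X hlog M archPk archSub Ψ act Mmod region n lat sig split qData thetaBox qCentre
        hq hfin).thetaRegion m j vQ =
      (settingDHVol X hlog M archPk archSub Ψ act Mmod region n lat sig split qData thetaBox qCentre
        hq hfin).thetaRegion 0 j vQ := by
  refine thetaRegion_settingDHVol_eq_zero_of_boxes X hlog M archPk archSub Ψ act Mmod region n lat
    sig split qData thetaBox qCentre hq hfin (fun m' j' vQ' => ?_) m j vQ
  rw [hhull m' j' vQ', hhull 0 j' vQ']
  exact hullSet_eq_of_norm_eq _ (hnorm m' j' vQ')

/-- **TEAM B capstone at `settingDHVol` with IDENTITY transports** — under `m`-independent Θ-boxes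
the two Kummer-realisation residuals of p417670 (`hΨ`, `hthetaEq0`) are discharged by `Ψm := id`
(`SummandPieces.preservesRegions_id`; the `m`-th image IS the `m = 0` image): the printed
`Statement` of [IUTchIII] Cor. 3.12 follows from `m`-independent Θ-boxes + `hbox0` (hull-set shape
of the reference box) + the (Ind3) residuals `hθ`/`hfinθ` + `ThetaFinite` + **the gap input
`Cor312Vol.GlobalVolumeTransport`** (G-c312-11-1-SUPPLEMENT, NOT asserted). The `m`-independence is
a feature of the hull-set box MODEL (see the module docstring's honest framing), exactly what the
polydisc shape of the printed regions `q^{j²}·𝒪` provides when the centres are read at fixed norms.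
[claim: Mochizuki2012, status: disputed] -/
theorem teamB_statement_of_globalVolumeTransport_settingDHVol_of_mIndepBoxes
    (hbox_eq : ∀ (m : ℤ) (j : (thetaIndex X).Label) (vQ : (thetaIndex X).VQ),
      thetaBox m (settingDHVol X hlog M archPk archSub Ψ act Mmod region n lat sig split qData
          thetaBox qCentre hq hfin).thetaPilot j vQ =
        thetaBox 0 (settingDHVol X hlog M archPk archSub Ψ act Mmod region n lat sig split qData
          thetaBox qCentre hq hfin).thetaPilot j vQ)
    (hbox0 : ∀ (i : Fin (thetaIndex X).lstar) (vQ : (thetaIndex X).VQ),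
      IsHullSet (factorFieldDH X hlog (Setting.labelSucc i) vQ)
        (thetaBox 0 (settingDHVol X hlog M archPk archSub Ψ act Mmod region n lat sig split qData
          thetaBox qCentre hq hfin).thetaPilot (Setting.labelSucc i) vQ))
    (hθ : ∀ (i : Fin (thetaIndex X).lstar) (vQ : (thetaIndex X).VQ),
      ((situationDHVol X hlog M archPk archSub Ψ act Mmod region).D n).Adm _ vQ
        ((settingDHVol X hlog M archPk archSub Ψ act Mmod region n lat sig split qData thetaBox
          qCentre hq hfin).thetaRegion3 (Setting.labelSucc i) vQ))
    (hfinθ : ∀ i : Fin (thetaIndex X).lstar, (Function.support fun vQ : (thetaIndex X).VQ =>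
      ((situationDHVol X hlog M archPk archSub Ψ act Mmod region).D n).logvol _ vQ
        ((settingDHVol X hlog M archPk archSub Ψ act Mmod region n lat sig split qData thetaBox
          qCentre hq hfin).thetaRegion3 (Setting.labelSucc i) vQ)).Finite)
    (finite : (settingDHVol X hlog M archPk archSub Ψ act Mmod region n lat sig split qData thetaBox
      qCentre hq hfin).ThetaFinite)
    (hgvt : GlobalVolumeTransport (settingDHVol X hlog M archPk archSub Ψ act Mmod region n lat sig
      split qData thetaBox qCentre hq hfin)) :
    (settingDHVol X hlog M archPk archSub Ψ act Mmod region n lat sig split qData thetaBox qCentre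
      hq hfin).Statement := by
  refine teamB_statement_of_globalVolumeTransport_settingDHVol X hlog M archPk archSub Ψ act Mmod
    region n lat sig split qData thetaBox qCentre hq hfin (fun _ _ _ => id)
    (fun _ j vQ => SummandPieces.preservesRegions_id (summandPiecesDH X hlog) j vQ) ?_ hbox0 hθ
    hfinθ finite hgvt
  intro m i vQ
  rw [image_id]
  rw [thetaRegion_settingDHVol_eq_zero_of_boxes X hlog M archPk archSub Ψ act Mmod region n lat sig
    split qData thetaBox qCentre hq hfin hbox_eq m (Setting.labelSucc i) vQ]

end Real

end Thm311

end IUTFork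

end Summit.ABC

end
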